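import Mathlib
import Summits.Ventures.FusionMHD.Models.SAlphaPolyWitnessS2A125Panels1
import HarnessLib

/-!
# F3 row «F3.BALLOON-sα-WITNESS-S2-A125»: at `(s, α) = (2, 5/4)` the `s–α` ballooning MODEL is on the UNSTABLE side — an explicit polynomial trial function on the window `[−8, 8]` with kernel-certified NEGATIVE energy (`SAlpha.UnstableWitness 2 (5/4) (−8) 8`); with the stable-side point at `(2, 1)` (★ #219) the first-stability edge at shear `2` is CERTIFIED to lie in `[1, 5/4]`

LADDER-GRIDFUSION rung F3 (cell `gridfusion`; lead g13 RULING 9fl (2)(a): at `s = 2` the next COUNTED object is a witness at `α ≤ 5/4`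
or a stable side at `α ≥ 5/4` — this file is the former).  Assembly by gridfusion-model-7 g8, 2026-08-28, of (i) the data file
`SAlphaPolyWitnessS2A125Defs` (the even degree-26 polynomial `X = UX`, `X(±8) = 0`, and the 22-statement density program `pw2Prog`), (ii) TWO
panel files `SAlphaPolyWitnessS2A125Panels0/1` (32 kernel-decided Taylor-model integral enclosures of the density on the grid `h = 1/8` of
`[0, 8]`, glued by `FSegOK.append`), and (iii) here: `Poly.deriv UX = UXd` (`decide`), the exact zeros `X(±8) = 0`, parity (`X` even, `X′`
odd ⇒ density even ⇒ `W[X; −8, 8] = 2∫₀⁸`), `FSegOK.bounds`, and lit-3's predicate `SAlpha.UnstableWitness`.  A NEW LANE beside ★ #184 /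
★ #192 (closed forms in `ℚ[π]` on windows `kπ`): rational windows, any polynomial degree, no `π` digits — the enclosure is the tree's
Taylor-model integral certificate (Mahboubi–Melquiond–Sibut-Pinote panels with Joldeş `sin`/`cos` models).  0 kit in the kernel objects; no
`native_decide`; `π` does not enter.

## THREE COLUMNS
CERTIFIED: in the `s–α` ballooning MODEL (Freidberg (12.96)–(12.99)) at `(s, α) = (2, 5/4)` the explicit trial function `X = Poly.eval UX` on
`[−8, 8]` (even polynomial of degree 26 vanishing at `±8`) has one-surface energy `W ≤ −3/50 < 0` (`X(0) ≈ 1`): `SAlpha.UnstableWitness 2 (5/4) (−8) 8 X X′`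
(`unstableWitness_two_54`).  With gridfusion-lit-4's ★ #219 `SAlpha.StableSide 2 1` (B-twin: model-7's `SAlphaStableS2A1.stableSide_two_one`) the
unstable set of the MODEL at shear `s = 2` misses `1` and contains `5/4` (and `3/2`, ★ #192): the first-stability edge at `s = 2` lies in `[1, 5/4]`,
half the previous certified gap `[1, 3/2]`.  VALIDATED (not in the kernel): model-7's RK4 shooting puts the edge at `α ≈ 1.177` (first zero
of the even solution at `θ ≈ 5.2` for `α = 5/4`); float energy of `X` `≈ −0.0610`, kernel enclosure of the half integral
`[−0.03059, −0.03045]`; the printed fit `α ≈ 0.6 s` (12.100) gives `1.2`.  MODELLED: `s–α` model (large-aspect-ratio shifted circles,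
high-`n` ballooning ordering, `θ₀ = 0`, ideal MHD); «unstable» = the MODEL's one-surface energy admits a negative compactly supported trial
function (lit-3's witness class; representation step `W̄ < 0 ⇒ δW < 0`, Connor–Hastie–Taylor 1979, quoted in the Literature file, NOT typed);
no device, no `β`-limit, no second-stability claim.  Citations: Freidberg 2014 §12.3 (12.38)–(12.40), §12.6.2 (12.97)–(12.100) [Freidberg2014];
Mahboubi–Melquiond–Sibut-Pinote 2016 [MahboubiMelquiondSibutpinote2016]; Makino–Berz 2003 [MakinoBerz2003].  Everything below is [instance data].
-/

open MeasureTheory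
open Literature.Analysis.ValidatedNumerics Literature.Analysis.ValidatedNumerics.PolyMP
open Literature.Analysis.ValidatedNumerics.NumericsMP Literature.Analysis.ValidatedNumerics.ExpPoly
open Literature.MathematicalPhysics.MHD.Ballooning
open Real Set

namespace Summit.Ventures.FusionMHD.Models

namespace SAlphaPolyWitnessS2A125

/-! ### §1 The trial function: derivative, zeros at `±8`, parity -/

/-- `Poly.deriv UX = UXd`. [instance data] -/
theorem deriv_UX : Poly.deriv UX = UXd := by
  decide +kernel

/-- `X(8) = 0` (exact). [instance data] -/
theorem UX_at_L : Poly.eval UX (8 : ℝ) = 0 := by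
  norm_num [UX, Poly.eval]

/-- `X(−8) = 0` (exact). [instance data] -/
theorem UX_at_negL : Poly.eval UX (-8 : ℝ) = 0 := by
  norm_num [UX, Poly.eval]

/-- `X` is even. [instance data] -/
theorem UX_even (θ : ℝ) : Poly.eval UX (-θ) = Poly.eval UX θ := by
  simp only [UX, Poly.eval]
  push_cast
  ring

/-- `X′` is odd. [instance data] -/
theorem UXd_odd (θ : ℝ) : Poly.eval UXd (-θ) = -Poly.eval UXd θ := by
  simp only [UXd, Poly.eval]
  push_cast
  ring

/-- `X′ = Poly.eval UXd` is the derivative of `X = Poly.eval UX` everywhere. [instance data] -/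
theorem hasDerivAt_UX (θ : ℝ) : HasDerivAt (Poly.eval UX) (Poly.eval UXd θ) θ := by
  have h := Poly.hasDerivAt_eval UX θ
  rwa [deriv_UX] at h

/-! ### §2 The energy density of `X`: parity, continuity, the certified half-window integral -/

/-- The energy density of the even `X` is even in `θ`. [instance data] -/
theorem density_even (θ : ℝ) : (SAlpha.energyDensity 2 (5 / 4) (Poly.eval UX) (Poly.eval UXd)) (-θ) = (SAlpha.energyDensity 2 (5 / 4) (Poly.eval UX) (Poly.eval UXd)) θ := by
  unfold SAlpha.energyDensity SAlpha.bending SAlpha.drive SAlpha.shearParam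
  rw [UX_even, UXd_odd, Real.sin_neg, Real.cos_neg]
  ring

/-- The energy density of `X` is continuous. [instance data] -/
theorem density_continuous : Continuous (SAlpha.energyDensity 2 (5 / 4) (Poly.eval UX) (Poly.eval UXd)) := by
  have h1 : Continuous (Poly.eval UX) := Poly.continuous_eval UX
  have h2 : Continuous (Poly.eval UXd) := Poly.continuous_eval UXd
  unfold SAlpha.energyDensity SAlpha.bending SAlpha.drive SAlpha.shearParam
  fun_prop

/-- THE CERTIFIED HALF-WINDOW INTEGRAL: `∫₀^8 [(1+Λ²)X′² − α(Λ sin θ + cos θ)X²] dθ ≤ -3/100` (kernel enclosure of the 32 panels: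
`[-0.030587, -0.030453]`; float value `-0.030519`). [instance data] -/
theorem half_integral_le : ∫ θ in (0 : ℝ)..8, (SAlpha.energyDensity 2 (5 / 4) (Poly.eval UX) (Poly.eval UXd)) θ ≤ (-3 / 100 : ℝ) := by
  have hseg := (pw2_seg0.append pw2_seg1)
  have hb := (hseg.bounds (by norm_num) (lo' := -1) (hi' := -3/100) (by norm_num) (by norm_num)).2
  have e0 : ((panelLeft (1/8 : ℚ) 0 : ℚ) : ℝ) = 0 := by norm_num [panelLeft]
  have e1 : ((panelLeft (1/8 : ℚ) 32 : ℚ) : ℝ) = 8 := by norm_num [panelLeft]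
  have ei : ∀ t : ℝ, (TProg.toFunP (pw2Prog UX UXd) []) t * Poly.eval [1] t = (SAlpha.energyDensity 2 (5 / 4) (Poly.eval UX) (Poly.eval UXd)) t := by
    intro t
    rw [toFunP_pw2Prog]
    simp [Poly.eval]
  rw [e0, e1] at hb
  simp only [ei] at hb
  norm_num at hb ⊢
  exact hb

/-- THE CERTIFIED ENERGY: `W[X; −8, 8] ≤ -3/50 < 0` (reflection `θ ↦ −θ` doubles the half-window integral). [instance data] -/
theorem energy_le : SAlpha.energy 2 (5 / 4) (Poly.eval UX) (Poly.eval UXd) (-8) 8 ≤ (-3 / 50 : ℝ) := by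
  unfold SAlpha.energy
  have hint : ∀ a b : ℝ, IntervalIntegrable (SAlpha.energyDensity 2 (5 / 4) (Poly.eval UX) (Poly.eval UXd)) volume a b :=
    fun a b => density_continuous.intervalIntegrable a b
  have hsplit := intervalIntegral.integral_add_adjacent_intervals (hint (-8) 0) (hint 0 8)
  have hrefl : ∫ θ in (-8 : ℝ)..0, (SAlpha.energyDensity 2 (5 / 4) (Poly.eval UX) (Poly.eval UXd)) θ = ∫ θ in (0 : ℝ)..8, (SAlpha.energyDensity 2 (5 / 4) (Poly.eval UX) (Poly.eval UXd)) θ := by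
    have h1 := intervalIntegral.integral_comp_neg (a := (0 : ℝ)) (b := 8) (SAlpha.energyDensity 2 (5 / 4) (Poly.eval UX) (Poly.eval UXd))
    simp only [neg_zero] at h1
    rw [← h1]
    exact intervalIntegral.integral_congr fun x _ => density_even x
  have hh := half_integral_le
  linarith

/-! ### §3 The witness -/

/-- **THE ROW: `(s, α) = (2, 5/4)` IS ON THE UNSTABLE SIDE OF THE `s–α` MODEL** — the explicit even polynomial `X = Poly.eval UX`
(degree 26, `X(±8) = 0`) is a compactly supported trial function on the window `[−8, 8]` with NEGATIVE one-surface energy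
(`≤ -3/50` with `X(0) ≈ 1`), i.e. an `SAlpha.UnstableWitness 2 (5/4) (−8) 8`.  MODEL `s–α`; «unstable» in the model's own one-surface (Newcomb / trial-function)
sense; nothing about a device. [instance data] -/
theorem unstableWitness_two_54 : SAlpha.UnstableWitness 2 (5 / 4) (-8) 8 (Poly.eval UX) (Poly.eval UXd) := by
  refine ⟨by norm_num, fun θ _ => hasDerivAt_UX θ, UX_at_negL, UX_at_L, ?_⟩
  have h := energy_le
  linarith

end SAlphaPolyWitnessS2A125

end Summit.Ventures.FusionMHD.Models
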